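import Mathlib.Tactic.Group
import Literature.AnabelianGeometry.SemiGraphs.PSCCoveringBranchData
import Literature.AnabelianGeometry.SemiGraphs.PSCGraphicity
import Literature.AnabelianGeometry.SemiGraphs.SubdivisionLemmas
import HarnessLib

/-!
# [CombGC] Def. 1.1 (i)/(ii), Rmk. 1.1.3: the finite étale covering semi-graphs `G_U` are CONNECTED

Mochizuki, *A combinatorial version of the Grothendieck conjecture* [CombGC] §1: Def. 1.1 (i) p. 6
(a semi-graph of anabelioids of PSC-type has a CONNECTED underlying semi-graph — the dual semi-graph
of a pointed stable curve), Def. 1.1 (ii) p. 6 ("a finite étale covering of `G` that arises from an open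
subgroup of `Π_G`" is again of PSC-type), Rmk. 1.1.3 p. 8. [cite: MochizukiCombGC2007, Def 1.1 p.6]
[cite: MochizukiCombGC2007, Rmk 1.1.3 p.8]; [SemiAnbd] §1 pp. 11–13 (connectedness of a semi-graph =
connectedness of its barycentric subdivision, abc-iut-L3-t1 `SemiGraph.IsConnected`)
[cite: MochizukiSemiAnbd2006, §1 pp.11-13].

PROOF-ONLY file (abc-iut cell, layer L3; seat abc-iut-w4-d052 gen 4, row «COVERING-GRAPH-CONNECTED»,
abc-iut-L3-lead β8).  abc-iut-L3-t4's `PSCSemiGraph.restrictGraphBD G U bd`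
(`PSCCoveringBranchData.lean`) is the underlying semi-graph of the covering datum `G_U`: vertices
`⊔_v U\Π/Π_v`, nodes `⊔_e U\Π/Π_e`, cusps `⊔_c U\Π/Π_c`, the node `U x Π_e` joining `U x γ₁⁻¹ Π_{v₁}`
and `U x γ₂⁻¹ Π_{v₂}` for the branch data `(v₁, v₂, γ₁, γ₂) = (bd.fst e, bd.snd e, bd.conjFst e,
bd.conjSnd e)`.  Here it is proved CONNECTED in abc-iut-L3-t1's sense
(`PSCSemiGraph.toSemiGraph`, `SemiGraph.IsConnected`: the barycentric subdivision is a connected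
simple graph) under the Bass–Serre hypotheses on the representatives:

* `PSCSemiGraph.toSemiGraph_isConnected_of_eqvGen` — a PSC semi-graph with a vertex, whose vertices
  are linked through its nodes, is connected (cusps hang off their vertices; branch- and edge-points
  off their edges);
* `PSCDatum.restrictGraphBD_nodeEnds_dcIdx` — the node of `G_U` through `x ∈ Π` over `e` joins the
  vertices through `x γ₁⁻¹` over `v₁` and through `x γ₂⁻¹` over `v₂` (independence of representatives);
* `PSCDatum.restrictGraphBD_eqvGen_nodeEnds` / **`PSCDatum.restrictGraphBD_toSemiGraph_isConnected`**
  — if the vertex set of `G` is connected along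
  the nodes with `γ₁ = γ₂` (a spanning tree along which the representatives are aligned) and the vertex
  groups `Π_v` together with the STABLE LETTERS `γ₁ γ₂⁻¹` topologically generate `Π` — the presentation
  of `Π_G` as the fundamental group of the graph of profinite groups of Def. 1.1 — then for every OPEN
  `U ≤ Π` of finite index the covering semi-graph `G_U` is connected: the set of `g` all of whose
  vertices `U g Π_v` lie in the component of `U Π_{v₀}` contains `1`, is stable under right
  multiplication by every `Π_w` and every `(γ₁γ₂⁻¹)^{±1}` (the node through `gγ₁` joins `UgΠ_{v₁}` to
  `Ugγ₁γ₂⁻¹Π_{v₂}`), hence contains the dense subgroup they generate, and `U` is open;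
* `PSCDatum.restrictGraphBD_toSemiGraph_isConnected_of_aligned` — the tree case `γ₁ = γ₂ = 1`
  (e.g. the two-component / two-tripod shapes of the cell's NV programme: `Π_e ≤ Π_{v₁} ∩ Π_{v₂}`,
  `Π_{v₁}·Π_{v₂}` dense); `…_of_oneVertex` (one vertex, self-nodes with stable letters: the
  irreducible-nodal shape); `…_of_vertGp_eq_top` (one vertex with `Π_v = Π`, ANY branch data: the
  smooth-proper / smooth-curve shapes of abc-iut-w5-d195's genuine origins; also for `G.restrict`,
  `restrict_graph_toSemiGraph_isConnected_of_vertGp_eq_top`);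
  `exists_branchData_restrictGraphBD_isConnected_of_twoVertex` (two-vertex tree data: the aligned
  branch data `(v₁, v₂, 1, 1)` and connectedness of all `G_U` built from them).

Companion of `PSCVertCountConnectivity*.lean` (same argument, there only the count `i ≤ n + 1`).  Group
theory over the interface; nothing here takes a side on [IUTchIII] Cor. 3.12.
-/

noncomputable section

namespace Literature.AnabelianGeometry.SemiGraphs

universe u

/-! ### A PSC semi-graph whose vertices are linked through nodes is connected -/

namespace PSCSemiGraph

/-- The two branches of a node abut to its two end vertices (in `toSemiGraph`).
[cite: MochizukiCombGC2007, Def 1.1(i) p.6] -/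
theorem exists_branch_abuts_of_nodeEnds (𝔾 : PSCSemiGraph) {e : 𝔾.N} {a b : 𝔾.V}
    (h : 𝔾.nodeEnds e = s(a, b)) :
    (∃ β : Bool, 𝔾.toSemiGraph.abuts (Sum.inl e, β) = some a) ∧
      ∃ β : Bool, 𝔾.toSemiGraph.abuts (Sum.inl e, β) = some b := by
  have hout : s((Quot.out (𝔾.nodeEnds e)).1, (Quot.out (𝔾.nodeEnds e)).2) = s(a, b) := by
    rw [← h]; exact Quot.out_eq _
  have hf : 𝔾.toSemiGraph.abuts (Sum.inl e, false) = some (Quot.out (𝔾.nodeEnds e)).1 := rfl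
  have ht : 𝔾.toSemiGraph.abuts (Sum.inl e, true) = some (Quot.out (𝔾.nodeEnds e)).2 := rfl
  rcases Sym2.eq_iff.mp hout with ⟨h1, h2⟩ | ⟨h1, h2⟩
  · exact ⟨⟨false, by rw [hf, h1]⟩, ⟨true, by rw [ht, h2]⟩⟩
  · exact ⟨⟨true, by rw [ht, h2]⟩, ⟨false, by rw [hf, h1]⟩⟩

/-- The two end vertices of a node are joined in the barycentric subdivision
(`v₁ — branch — e — branch — v₂`). [cite: MochizukiSemiAnbd2006, §1 pp.11-12] -/
theorem subdivision_reachable_of_nodeEnds (𝔾 : PSCSemiGraph) {e : 𝔾.N} {a b : 𝔾.V}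
    (h : 𝔾.nodeEnds e = s(a, b)) :
    𝔾.toSemiGraph.subdivision.Reachable (Sum.inl a) (Sum.inl b) := by
  obtain ⟨⟨β₁, h₁⟩, ⟨β₂, h₂⟩⟩ := 𝔾.exists_branch_abuts_of_nodeEnds h
  have r₁ := 𝔾.toSemiGraph.subdivision_reachable_branch_vertex h₁
  have r₂ := 𝔾.toSemiGraph.subdivision_reachable_branch_vertex h₂
  have e₁ : 𝔾.toSemiGraph.subdivision.Reachable (Sum.inr (Sum.inl (Sum.inl e)))
      (Sum.inr (Sum.inr (Sum.inl e, β₁))) :=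
    𝔾.toSemiGraph.subdivision_reachable_edge_branch (Sum.inl e, β₁)
  have e₂ : 𝔾.toSemiGraph.subdivision.Reachable (Sum.inr (Sum.inl (Sum.inl e)))
      (Sum.inr (Sum.inr (Sum.inl e, β₂))) :=
    𝔾.toSemiGraph.subdivision_reachable_edge_branch (Sum.inl e, β₂)
  exact r₁.symm.trans (e₁.symm.trans (e₂.trans r₂))

/-- **Connectedness criterion for a PSC semi-graph.**  If `𝔾` has a vertex and any two vertices are
linked by a chain of nodes, then `𝔾` is connected in the sense of [SemiAnbd] §1 (its barycentric
subdivision is connected): every cusp hangs off its vertex, every edge-point off an abutting branch,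
every branch-point off its edge. [cite: MochizukiSemiAnbd2006, §1 pp.11-13] -/
theorem toSemiGraph_isConnected_of_eqvGen (𝔾 : PSCSemiGraph) (v₀ : 𝔾.V)
    (h : ∀ v w : 𝔾.V, Relation.EqvGen (fun a b => ∃ e, 𝔾.nodeEnds e = s(a, b)) v w) :
    𝔾.toSemiGraph.IsConnected := by
  have hV : ∀ v w : 𝔾.V, 𝔾.toSemiGraph.subdivision.Reachable (Sum.inl v) (Sum.inl w) := by
    intro v w
    induction h v w with
    | rel a b hab =>
      obtain ⟨e, he⟩ := hab
      exact 𝔾.subdivision_reachable_of_nodeEnds he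
    | refl a => exact SimpleGraph.Reachable.refl _
    | symm a b _ ih => exact ih.symm
    | trans a b c _ _ ih₁ ih₂ => exact ih₁.trans ih₂
  -- every edge-point is reachable from `v₀` through a branch abutting to a vertex
  have hedge : ∀ ed : 𝔾.N ⊕ 𝔾.C,
      𝔾.toSemiGraph.subdivision.Reachable (Sum.inl v₀) (Sum.inr (Sum.inl ed)) := by
    intro ed
    rcases ed with e | c
    · have hb : 𝔾.toSemiGraph.abuts (Sum.inl e, false) = some (Quot.out (𝔾.nodeEnds e)).1 := rfl
      have r := 𝔾.toSemiGraph.subdivision_reachable_branch_vertex hb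
      have r' : 𝔾.toSemiGraph.subdivision.Reachable (Sum.inr (Sum.inl (Sum.inl e)))
          (Sum.inr (Sum.inr (Sum.inl e, false))) :=
        𝔾.toSemiGraph.subdivision_reachable_edge_branch (Sum.inl e, false)
      exact ((hV v₀ _).trans r.symm).trans r'.symm
    · have hb : 𝔾.toSemiGraph.abuts (Sum.inr c, false) = some (𝔾.cuspEnd c) := rfl
      have r := 𝔾.toSemiGraph.subdivision_reachable_branch_vertex hb
      have r' : 𝔾.toSemiGraph.subdivision.Reachable (Sum.inr (Sum.inl (Sum.inr c)))
          (Sum.inr (Sum.inr (Sum.inr c, false))) :=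
        𝔾.toSemiGraph.subdivision_reachable_edge_branch (Sum.inr c, false)
      exact ((hV v₀ _).trans r.symm).trans r'.symm
  have hall : ∀ x : 𝔾.toSemiGraph.Node, 𝔾.toSemiGraph.subdivision.Reachable (Sum.inl v₀) x := by
    intro x
    rcases x with v | ed | br
    · exact hV v₀ v
    · exact hedge ed
    · exact (hedge br.1).trans (𝔾.toSemiGraph.subdivision_reachable_edge_branch br)
  haveI : Nonempty 𝔾.toSemiGraph.Node := ⟨Sum.inl v₀⟩
  exact ⟨⟨fun x y => (hall x).symm.trans (hall y)⟩⟩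

end PSCSemiGraph

/-! ### The covering semi-graphs `G_U` -/

namespace PSCDatum

open scoped Pointwise
open PSCCovering

variable {P : Type u} [Group P] [TopologicalSpace P] [IsTopologicalGroup P] (G : PSCDatum P)
  (U : Subgroup P) [U.FiniteIndex] (bd : G.BranchData)

omit [IsTopologicalGroup P] in
/-- The vertex of `G_U` over `v` through `u · x · k` (`u ∈ U`, `k` in a subgroup conjugated into
`Π_v` by `γ`) read at `γ⁻¹` is the vertex through `x γ⁻¹`: `U (uxk) γ⁻¹ Π_v = U x γ⁻¹ Π_v`.
[cite: MochizukiCombGC2007, Def 1.1(ii) p.6] -/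
theorem vertexOver_mul_conj_inv {E : Subgroup P} {v : G.graph.V} {γ : ConjAct P}
    (hγ : γ • E ≤ G.vertGp v) {u x k : P} (hu : u ∈ U) (hk : k ∈ E) :
    G.vertexOver U v (u * x * k * (ConjAct.ofConjAct γ)⁻¹) =
      G.vertexOver U v (x * (ConjAct.ofConjAct γ)⁻¹) := by
  unfold PSCDatum.vertexOver
  simp only [Sigma.mk.injEq, heq_eq_eq, true_and]
  rw [dcIdx_eq_iff]
  refine ⟨u⁻¹, U.inv_mem hu, γ • k⁻¹, hγ (Subgroup.smul_mem_pointwise_smul _ _ _ (E.inv_mem hk)), ?_⟩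
  rw [ConjAct.smul_def]
  group

omit [IsTopologicalGroup P] in
/-- **The node of `G_U` through `x`.**  The node `U x Π_e` of `G_U` (index `dcIdx U Π_e x`) joins the
vertex `U x γ₁⁻¹ Π_{v₁}` to the vertex `U x γ₂⁻¹ Π_{v₂}` — for ANY `x` in the double coset, not only
the enumerated representative. [cite: MochizukiCombGC2007, Def 1.1(ii) p.6] -/
theorem restrictGraphBD_nodeEnds_dcIdx (e : G.graph.N) (x : P) :
    (G.restrictGraphBD U bd).nodeEnds ⟨e, dcIdx U (G.nodeGp e) x⟩ =
      s(G.vertexOver U (bd.fst e) (x * (ConjAct.ofConjAct (bd.conjFst e))⁻¹),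
        G.vertexOver U (bd.snd e) (x * (ConjAct.ofConjAct (bd.conjSnd e))⁻¹)) := by
  rw [restrictGraphBD_nodeEnds]
  obtain ⟨u, hu, k, hk, hrep⟩ := exists_dcRep_dcIdx_eq U (G.nodeGp e) x
  have hn : G.nrep U ⟨e, dcIdx U (G.nodeGp e) x⟩ = u * x * k := hrep
  rw [hn, G.vertexOver_mul_conj_inv U (bd.conjFst_smul_le e) hu hk,
    G.vertexOver_mul_conj_inv U (bd.conjSnd_smul_le e) hu hk]

/-- **Any two vertices of `G_U` are linked through its nodes.**  Let `G : PSCDatum Π` with branch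
data `bd` such that the vertex set is connected along the nodes with `γ₁ = γ₂` (representatives
aligned along a spanning tree) and the vertex groups `Π_v` together with the stable letters `γ₁ γ₂⁻¹`
topologically generate `Π`.  Then for every OPEN subgroup `U ≤ Π` of finite index any two vertices of
`G.restrictGraphBD U bd` are joined by a chain of its nodes. [cite: MochizukiCombGC2007, Def 1.1(ii) p.6] -/
theorem restrictGraphBD_eqvGen_nodeEnds (hU : IsOpen (U : Set P)) (v₀ : G.graph.V)
    (hconn : ∀ v w : G.graph.V, Relation.EqvGen (fun a b => ∃ e, bd.conjFst e = bd.conjSnd e ∧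
      bd.fst e = a ∧ bd.snd e = b) v w)
    (hgen : ((⨆ v, G.vertGp v) ⊔ Subgroup.closure (Set.range fun e =>
      ConjAct.ofConjAct (bd.conjFst e) * (ConjAct.ofConjAct (bd.conjSnd e))⁻¹)).topologicalClosure = ⊤) :
    ∀ x y : (G.restrictGraphBD U bd).V,
      Relation.EqvGen (fun a b => ∃ d, (G.restrictGraphBD U bd).nodeEnds d = s(a, b)) x y := by
  classical
  -- the vertices `U g Π_v` and the adjacency relation through the nodes of `G_U`
  let ρ : P → G.graph.V → (G.restrictGraphBD U bd).V := fun g v => G.vertexOver U v g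
  let R : (G.restrictGraphBD U bd).V → (G.restrictGraphBD U bd).V → Prop :=
    fun a b => ∃ d, (G.restrictGraphBD U bd).nodeEnds d = s(a, b)
  -- stable letters
  let t : G.graph.N → P := fun e => ConjAct.ofConjAct (bd.conjFst e) * (ConjAct.ofConjAct (bd.conjSnd e))⁻¹
  -- the node through `x γ₁` joins `U x Π_{v₁}` to `U x t_e Π_{v₂}`
  have hadj : ∀ (e : G.graph.N) (x : P), R (ρ x (bd.fst e)) (ρ (x * t e) (bd.snd e)) := by
    intro e x
    refine ⟨⟨e, dcIdx U (G.nodeGp e) (x * ConjAct.ofConjAct (bd.conjFst e))⟩, ?_⟩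
    rw [G.restrictGraphBD_nodeEnds_dcIdx U bd, mul_inv_cancel_right, mul_assoc]
    rfl
  -- `U g h Π_w = U g Π_w` for `h ∈ Π_w`
  have hρ : ∀ (g h : P) (w : G.graph.V), h ∈ G.vertGp w → ρ (g * h) w = ρ g w := by
    intro g h w hh
    change G.vertexOver U w (g * h) = G.vertexOver U w g
    unfold PSCDatum.vertexOver
    simp only [Sigma.mk.injEq, heq_eq_eq, true_and]
    rw [dcIdx_eq_iff]
    exact ⟨1, U.one_mem, h⁻¹, (G.vertGp w).inv_mem hh, by group⟩
  -- (1) the tree chain translated by `g`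
  have step1 : ∀ (g : P) (v w : G.graph.V), Relation.EqvGen R (ρ g v) (ρ g w) := by
    intro g v w
    induction hconn v w with
    | rel a b hab =>
      obtain ⟨e, hγ, rfl, rfl⟩ := hab
      have ht : t e = 1 := by
        change ConjAct.ofConjAct (bd.conjFst e) * (ConjAct.ofConjAct (bd.conjSnd e))⁻¹ = 1
        rw [hγ, mul_inv_cancel]
      have h := hadj e g
      rw [ht, mul_one] at h
      exact Relation.EqvGen.rel _ _ h
    | refl a => exact Relation.EqvGen.refl _
    | symm a b _ ih => exact Relation.EqvGen.symm _ _ ih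
    | trans a b c _ _ ih₁ ih₂ => exact Relation.EqvGen.trans _ _ _ ih₁ ih₂
  -- (2) closure induction over the vertex groups and the stable letters
  have step2 : ∀ g ∈ Subgroup.closure ((⋃ v, (G.vertGp v : Set P)) ∪ Set.range t), ∀ v,
      Relation.EqvGen R (ρ g v) (ρ 1 v₀) := by
    intro g hg
    refine Subgroup.closure_induction_right (p := fun g _ => ∀ v, Relation.EqvGen R (ρ g v) (ρ 1 v₀))
      (fun v => step1 1 v v₀) ?_ ?_ hg
    · rintro x _ y (hy | ⟨e, rfl⟩) ih v
      · obtain ⟨w, hw⟩ := Set.mem_iUnion.mp hy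
        exact Relation.EqvGen.trans _ _ _ (step1 (x * y) v w) ((hρ x y w hw) ▸ ih w)
      · -- `y = t e`: the node through `x γ₁` joins `U x Π_{v₁}` (in the component) to `U x t_e Π_{v₂}`
        exact Relation.EqvGen.trans _ _ _ (step1 (x * t e) v (bd.snd e))
          (Relation.EqvGen.trans _ _ _ (Relation.EqvGen.symm _ _ (Relation.EqvGen.rel _ _ (hadj e x)))
            (ih (bd.fst e)))
    · rintro x _ y (hy | ⟨e, rfl⟩) ih v
      · obtain ⟨w, hw⟩ := Set.mem_iUnion.mp hy
        exact Relation.EqvGen.trans _ _ _ (step1 (x * y⁻¹) v w)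
          ((hρ x y⁻¹ w ((G.vertGp w).inv_mem hw)) ▸ ih w)
      · -- `y = t e`: the node through `x t_e⁻¹ γ₁` joins `U x t_e⁻¹ Π_{v₁}` to `U x Π_{v₂}`
        have h := hadj e (x * (t e)⁻¹)
        rw [inv_mul_cancel_right] at h
        exact Relation.EqvGen.trans _ _ _ (step1 (x * (t e)⁻¹) v (bd.fst e))
          (Relation.EqvGen.trans _ _ _ (Relation.EqvGen.rel _ _ h) (ih (bd.snd e)))
  -- (3) density: every coset `U g` meets that subgroup (`U` open)
  have step3 : ∀ g : P, ∃ d ∈ Subgroup.closure ((⋃ v, (G.vertGp v : Set P)) ∪ Set.range t),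
      ∃ u ∈ U, d = u * g := by
    intro g
    have hD : Dense ((Subgroup.closure ((⋃ v, (G.vertGp v : Set P)) ∪ Set.range t) :
        Subgroup P) : Set P) := by
      have hgen' := hgen
      rw [Subgroup.iSup_eq_closure, ← Subgroup.closure_union] at hgen'
      have hc := congrArg SetLike.coe hgen'
      rw [Subgroup.topologicalClosure_coe, Subgroup.coe_top] at hc
      exact dense_iff_closure_eq.mpr hc
    obtain ⟨d, hdO, hdD⟩ := hD.inter_open_nonempty {x | x * g⁻¹ ∈ (U : Set P)}
      (hU.preimage (continuous_id.mul continuous_const)) ⟨g, by simp [U.one_mem]⟩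
    exact ⟨d, hdD, d * g⁻¹, hdO, by group⟩
  -- (4) every vertex of `G_U` lies in the component of `U Π_{v₀}`
  have step4 : ∀ z : (G.restrictGraphBD U bd).V, Relation.EqvGen R z (ρ 1 v₀) := by
    rintro ⟨v, i⟩
    obtain ⟨d, hd, u, hu, hdu⟩ := step3 (dcRep U (G.vertGp v) i)
    have h1 : (⟨v, i⟩ : (G.restrictGraphBD U bd).V) = ρ d v := by
      change (⟨v, i⟩ : Σ v : G.graph.V, dcFin U (G.vertGp v)) = G.vertexOver U v d
      unfold PSCDatum.vertexOver
      simp only [Sigma.mk.injEq, heq_eq_eq, true_and]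
      rw [← dcIdx_dcRep U (G.vertGp v) i, dcIdx_eq_iff]
      exact ⟨u, hu, 1, (G.vertGp v).one_mem, by rw [hdu, mul_one]⟩
    rw [h1]
    exact step2 d hd v
  intro x y
  exact Relation.EqvGen.trans _ _ _ (step4 x) (Relation.EqvGen.symm _ _ (step4 y))

/-- **[CombGC] Def. 1.1 (i)/(ii): the covering semi-graphs `G_U` are connected.**  Under the same
Bass–Serre hypotheses (tree-aligned representatives, vertex groups and stable letters generating),
for every OPEN subgroup `U ≤ Π` of finite index the underlying semi-graph `G.restrictGraphBD U bd` of
the covering `G_U` is CONNECTED (`SemiGraph.IsConnected` of its `toSemiGraph`).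
[cite: MochizukiCombGC2007, Def 1.1(ii) p.6] -/
theorem restrictGraphBD_toSemiGraph_isConnected (hU : IsOpen (U : Set P)) (v₀ : G.graph.V)
    (hconn : ∀ v w : G.graph.V, Relation.EqvGen (fun a b => ∃ e, bd.conjFst e = bd.conjSnd e ∧
      bd.fst e = a ∧ bd.snd e = b) v w)
    (hgen : ((⨆ v, G.vertGp v) ⊔ Subgroup.closure (Set.range fun e =>
      ConjAct.ofConjAct (bd.conjFst e) * (ConjAct.ofConjAct (bd.conjSnd e))⁻¹)).topologicalClosure = ⊤) :
    (G.restrictGraphBD U bd).toSemiGraph.IsConnected :=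
  (G.restrictGraphBD U bd).toSemiGraph_isConnected_of_eqvGen (G.vertexOver U v₀ 1)
    (G.restrictGraphBD_eqvGen_nodeEnds U bd hU v₀ hconn hgen)

/-- **The tree case.**  If the branch data have ALL conjugators trivial (`Π_e ≤ Π_{v₁} ∩ Π_{v₂}`,
representatives aligned along the whole — then necessarily tree-shaped — dual graph), the vertex set is
connected along the nodes, and the vertex groups topologically generate `Π`, then every covering
semi-graph `G_U` (`U` open of finite index) is connected.  E.g. the two-component and two-tripod shapes
of the cell's NV programme. [cite: MochizukiCombGC2007, Def 1.1(ii) p.6] -/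
theorem restrictGraphBD_toSemiGraph_isConnected_of_aligned (hU : IsOpen (U : Set P)) (v₀ : G.graph.V)
    (h1 : ∀ e, bd.conjFst e = 1) (h2 : ∀ e, bd.conjSnd e = 1)
    (hconn : ∀ v w : G.graph.V, Relation.EqvGen (fun a b => ∃ e, bd.fst e = a ∧ bd.snd e = b) v w)
    (hgen : (⨆ v, G.vertGp v).topologicalClosure = ⊤) :
    (G.restrictGraphBD U bd).toSemiGraph.IsConnected := by
  refine G.restrictGraphBD_toSemiGraph_isConnected U bd hU v₀ (fun v w => ?_) ?_
  · refine Relation.EqvGen.mono (fun a b hab => ?_) v w (hconn v w)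
    obtain ⟨e, ha, hb⟩ := hab
    exact ⟨e, by rw [h1 e, h2 e], ha, hb⟩
  · rw [eq_top_iff, ← hgen]
    exact Subgroup.topologicalClosure_mono le_sup_left

/-- **One-vertex data** (any branch data): if `v₀` is the only vertex and `Π_{v₀}` together with the
stable letters `γ₁ γ₂⁻¹` of the self-nodes topologically generates `Π` (e.g. the irreducible-nodal
shape: `Π_{v₀} = closure ι(F)`, stable letter `ι(b_g)`), then every covering semi-graph `G_U` (`U` open
of finite index) is connected. [cite: MochizukiCombGC2007, Def 1.1(ii) p.6] -/
theorem restrictGraphBD_toSemiGraph_isConnected_of_oneVertex (hU : IsOpen (U : Set P))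
    (v₀ : G.graph.V) (hV : ∀ w, w = v₀)
    (hgen : (G.vertGp v₀ ⊔ Subgroup.closure (Set.range fun e =>
      ConjAct.ofConjAct (bd.conjFst e) * (ConjAct.ofConjAct (bd.conjSnd e))⁻¹)).topologicalClosure = ⊤) :
    (G.restrictGraphBD U bd).toSemiGraph.IsConnected := by
  refine G.restrictGraphBD_toSemiGraph_isConnected U bd hU v₀ (fun v w => ?_) ?_
  · rw [hV v, hV w]
    exact Relation.EqvGen.refl _
  · rw [eq_top_iff, ← hgen]
    exact Subgroup.topologicalClosure_mono (sup_le_sup_right (le_iSup (fun v => G.vertGp v) v₀) _)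

/-- **One-vertex data with `Π_{v₀} = Π`** (the smooth-proper / smooth-curve shapes; any node and cusp
groups, ANY branch data): every covering semi-graph `G_U` (`U` open of finite index) is connected —
it has the single vertex `U \ Π / Π`. [cite: MochizukiCombGC2007, Def 1.1(ii) p.6] -/
theorem restrictGraphBD_toSemiGraph_isConnected_of_vertGp_eq_top (hU : IsOpen (U : Set P))
    (v₀ : G.graph.V) (hV : ∀ w, w = v₀) (htop : G.vertGp v₀ = ⊤) :
    (G.restrictGraphBD U bd).toSemiGraph.IsConnected := by
  refine G.restrictGraphBD_toSemiGraph_isConnected_of_oneVertex U bd hU v₀ hV ?_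
  rw [eq_top_iff, htop, top_sup_eq]
  exact Subgroup.le_topologicalClosure _

/-- The same for abc-iut-L3-t4's `restrict` (chosen branch data): at one-vertex data with `Π_v = Π`
the underlying semi-graph `(G.restrict U hU).graph = G.restrictGraph U` of every covering is connected
(the form consumed at the genuine smooth-proper / smooth-curve origins, `restrict_smoothCurveGenuine`).
[cite: MochizukiCombGC2007, Def 1.1(ii) p.6] -/
theorem restrict_graph_toSemiGraph_isConnected_of_vertGp_eq_top (hU : IsOpen (U : Set P))
    (v₀ : G.graph.V) (hV : ∀ w, w = v₀) (htop : G.vertGp v₀ = ⊤) :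
    (G.restrict U hU).graph.toSemiGraph.IsConnected :=
  G.restrictGraphBD_toSemiGraph_isConnected_of_vertGp_eq_top U G.chosenBranchData hU v₀ hV htop

/-- **Two-vertex tree data.**  If every vertex is `v₁` or `v₂`, every node joins `v₁` to `v₂` with
`Π_e ≤ Π_{v₁} ∩ Π_{v₂}`, and `Π_{v₁} · Π_{v₂}` is dense (the two-component and two-tripod shapes of the
cell's NV programme, cf. `PSCVertCountConnectivityShapes.lean`), then the ALIGNED branch data
`(v₁, v₂, 1, 1)` exist and every covering semi-graph `G_U` built from them (`U` open of finite index)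
is connected. [cite: MochizukiCombGC2007, Def 1.1(ii) p.6] -/
theorem exists_branchData_restrictGraphBD_isConnected_of_twoVertex (v₁ v₂ : G.graph.V)
    (hV : ∀ w, w = v₁ ∨ w = v₂) (e₀ : G.graph.N) (hE : ∀ e, G.graph.nodeEnds e = s(v₁, v₂))
    (hN : ∀ e, G.nodeGp e ≤ G.vertGp v₁ ∧ G.nodeGp e ≤ G.vertGp v₂)
    (hgen : (G.vertGp v₁ ⊔ G.vertGp v₂).topologicalClosure = ⊤) :
    ∃ bd : G.BranchData, (∀ e, bd.fst e = v₁ ∧ bd.snd e = v₂ ∧ bd.conjFst e = 1 ∧ bd.conjSnd e = 1) ∧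
      ∀ (U : Subgroup P) [U.FiniteIndex], IsOpen (U : Set P) →
        (G.restrictGraphBD U bd).toSemiGraph.IsConnected := by
  let bd : G.BranchData :=
    { fst := fun _ => v₁
      snd := fun _ => v₂
      conjFst := fun _ => 1
      conjSnd := fun _ => 1
      nodeEnds_eq := hE
      conjFst_smul_le := fun e => by rw [one_smul]; exact (hN e).1
      conjSnd_smul_le := fun e => by rw [one_smul]; exact (hN e).2 }
  refine ⟨bd, fun e => ⟨rfl, rfl, rfl, rfl⟩, fun U _ hU => ?_⟩
  refine G.restrictGraphBD_toSemiGraph_isConnected_of_aligned U bd hU v₁ (fun _ => rfl) (fun _ => rfl)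
    (fun v w => ?_) ?_
  · -- `{v₁, v₂}` is connected through `e₀`
    have hto : ∀ w, Relation.EqvGen (fun a b : G.graph.V => ∃ e : G.graph.N, bd.fst e = a ∧ bd.snd e = b)
        w v₁ := by
      intro w
      rcases hV w with rfl | rfl
      · exact Relation.EqvGen.refl _
      · exact Relation.EqvGen.symm _ _ (Relation.EqvGen.rel _ _ ⟨e₀, rfl, rfl⟩)
    exact Relation.EqvGen.trans _ _ _ (hto v) (Relation.EqvGen.symm _ _ (hto w))
  · rw [eq_top_iff, ← hgen]
    exact Subgroup.topologicalClosure_minimal _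
      ((sup_le (le_iSup (fun v => G.vertGp v) v₁) (le_iSup (fun v => G.vertGp v) v₂)).trans
        (Subgroup.le_topologicalClosure _)) (Subgroup.isClosed_topologicalClosure _)

end PSCDatum

end Literature.AnabelianGeometry.SemiGraphs

end
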